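import Literature.NumberTheory.Automorphic.UnitaryGroupTruncatedTracePolynomialOffBorel
import Literature.NumberTheory.Automorphic.UnitaryGroupTruncatedTraceClassElliptic
import Literature.NumberTheory.Automorphic.UnitaryGroupCharpolyClassMap
import HarnessLib

/-!
# `J(f) = Σ_{𝔬 elliptic} c_μ Σ'_{s ⊆ 𝔬} vol · Φ(γ_s, f) + Σ_{𝔬 meeting B(F)} p_𝔬(0)` on the quasi-split `U(J₃)` of a CM field

(Rogawski, *Automorphic Representations of Unitary Groups in Three Variables* (1990), §2.2–§2.3, pp. 13–14: the
classes `𝔬` missing every proper rational parabolic contribute `J_𝔬(f) = J^T_𝔬(f) = Σ_{γ ∈ 𝔬/∼} vol(G_γ(F)\G_γ(𝔸))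
· Φ(γ, f)`; Arthur, Duke Math. J. 45 (1978), §8; Arthur, Ann. of Math. 114 (1981), Prop. 2.3; Gelbart (1975),
(9.13), Thm. 9.22 (ii).)

Topic `NumberTheory/Automorphic`; namespace `Literature.NumberTheory.Automorphic.UnitaryGroup`. THEOREMS ONLY over
accepted tree modules: no definition, no named fact, no instance, no notation, no `sorry`. The J(f)-LEVEL FOLD of the
T1-qs LAW 4 of `Cruxes/H413/Lines/F0_T1InnerFormTraceIdentity.lean` (cell `pub/hodgecm-mathlib`, crux H413): the
constant term of the fine `𝔬`-expansion split at `B(F)` (★ (3d)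
`arthurTrace_eq_sum_offBorel_add_sum_charpoly_cm`, `UnitaryGroupTruncatedTracePolynomialOffBorel`) with its first
sum — the classes `𝔬 = charpoly⁻¹{i}` missing the rational Borel `B(L⁺)` — rewritten class by class through the
LAW 4 trunk closer ★ (L4-d) `truncatedTraceClass_eq_mul_tsum_covol_mul_orbitalIntegral_cm`
(`UnitaryGroupTruncatedTraceClassElliptic`): `J^T_𝔬(f) = c_μ · Σ'_{s ⊆ 𝔬} vol(G_{γ_s}(L⁺)\G_{γ_s}(𝔸)) ·
Φ_{ν/ν_s}(γ_s, f)`.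

* **`arthurTrace_eq_sum_orbital_add_sum_charpoly_cm`** — the CM pair `(L⁺, L, complexConj)`, class map
  `charpoly ∘ adelicVal` (conjugation invariant by ★ `isConjInvariant_charpoly_adelicVal`), NO hypothesis beyond the
  letters (`μ` automorphic, `ν₀` a Haar measure of `N(𝔸)` with a fundamental domain `𝓕` of `N(L⁺)`, `ν` a Haar
  measure of `G(𝔸)`, `rep` a choice of representatives of the `G(L⁺)`-conjugacy classes, `ν_s` Haar measures of the
  centralisers `G_{γ_s}(𝔸)`, `f` a test function): with the LAW-3 closer's finite class set `S_f` and class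
  polynomials `p_𝔬` (degree `≤ 1`, computing `J^T_𝔬(f)` above a threshold, summing to Arthur's polynomial, constant
  `= C (J^T_𝔬(f))` off `B(L⁺)`), for EVERY `T`,

    `J(f) = Σ_{𝔬 ∈ S_f, 𝔬 ∩ B(L⁺) = ∅} c_μ · Σ'_{s ⊆ 𝔬} vol(G_{γ_s}(L⁺)\G_{γ_s}(𝔸)) · Φ_{ν/ν_s}(γ_s, f)
            + Σ_{𝔬 ∈ S_f, 𝔬 ∩ B(L⁺) ≠ ∅} p_𝔬(0)`.

  The first sum runs over the ATTACHED finite set (`Finset.attach`), because the right invariance and the inversion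
  invariance of the centraliser measures `ν_s` — instance arguments of the Weil quotient measures carrying the
  covolume and the orbital integral — are THEOREMS only at the classes missing `B(L⁺)` (★
  `isMulRightInvariant_centralizer_of_forall_cl_ne`, ★ `isInvInvariant_centralizer_of_forall_cl_ne`) and are
  installed inside each summand from the membership proof.

## References

* J. D. Rogawski, *Automorphic Representations of Unitary Groups in Three Variables*, Ann. of Math. Stud. 123
  (1990), §2.2–§2.3 (pp. 13–14) [Rogawski1990].
* J. Arthur, *A trace formula for reductive groups I*, Duke Math. J. 45 (1978), §8 [Arthur1978TraceFormulaI].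
* J. Arthur, *The trace formula in invariant form*, Ann. of Math. 114 (1981), Prop. 2.3
  [Arthur1981TraceFormulaInvariantForm].
* S. Gelbart, *Automorphic forms on adele groups*, Ann. of Math. Stud. 83 (1975), (9.13), Thm. 9.22 (ii)
  [Gelbart1975].
-/

set_option autoImplicit false

noncomputable section

open MeasureTheory Measure NumberField NumberField.mixedEmbedding IsDedekindDomain Set Polynomial Topology
open Literature.MeasureTheory.Group
open scoped NNReal ENNReal Pointwise MatrixGroups Classical

namespace Literature.NumberTheory.Automorphic

namespace UnitaryGroup

/-- **`J(f) = Σ_{𝔬 ∈ S_f, 𝔬 ∩ B(L⁺) = ∅} c_μ Σ'_{s ⊆ 𝔬} vol(G_{γ_s}(L⁺)\G_{γ_s}(𝔸)) · Φ_{ν/ν_s}(γ_s, f) +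
Σ_{𝔬 ∈ S_f, 𝔬 ∩ B(L⁺) ≠ ∅} p_𝔬(0)` on the quasi-split `U(J₃)` of a CM extension `L/L⁺`** (class map
`charpoly ∘ adelicVal`, NO hypothesis beyond the letters): the constant term of Arthur's fine `𝔬`-expansion
★ `arthurTrace_eq_sum_offBorel_add_sum_charpoly_cm` with every class missing `B(L⁺)` unfolded into orbital
integrals by ★ `truncatedTraceClass_eq_mul_tsum_covol_mul_orbitalIntegral_cm` — for every `T`, with
`c_μ = unfoldingConstant G(L⁺) count μ ν`, the covolume of `G_{γ_s}(L⁺)` in `G_{γ_s}(𝔸)` for `ν_s` and the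
counting measure, and `Φ_{ν/ν_s}(γ_s, f)` the orbital integral against the Weil quotient measure `dν/dν_s`.
[cite: Rogawski1990, §2.2–2.3 (pp. 13–14)] [cite: Arthur1978TraceFormulaI, §8]
[cite: Arthur1981TraceFormulaInvariantForm, Prop. 2.3] [cite: Gelbart1975, (9.13) and Thm. 9.22 (ii)] -/
theorem arthurTrace_eq_sum_orbital_add_sum_charpoly_cm (L : Type) [Field L] [NumberField L] [IsCMField L]
    [instMA : MeasurableSpace (quasiSplit (↥(maximalRealSubfield L)) L (IsCMField.complexConj L) 3).Adelic] [instBA : BorelSpace (quasiSplit (↥(maximalRealSubfield L)) L (IsCMField.complexConj L) 3).Adelic]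
    [instMU : MeasurableSpace (adelicUnipotent (↥(maximalRealSubfield L)) L (IsCMField.complexConj L) 3)]
    [instBU : BorelSpace (adelicUnipotent (↥(maximalRealSubfield L)) L (IsCMField.complexConj L) 3)]
    [instMQ : ∀ γ : (quasiSplit (↥(maximalRealSubfield L)) L (IsCMField.complexConj L) 3).Adelic,
      MeasurableSpace ((quasiSplit (↥(maximalRealSubfield L)) L (IsCMField.complexConj L) 3).Adelic ⧸
        Subgroup.centralizer ({γ} : Set (quasiSplit (↥(maximalRealSubfield L)) L (IsCMField.complexConj L) 3).Adelic))]
    [instBQ : ∀ γ : (quasiSplit (↥(maximalRealSubfield L)) L (IsCMField.complexConj L) 3).Adelic,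
      BorelSpace ((quasiSplit (↥(maximalRealSubfield L)) L (IsCMField.complexConj L) 3).Adelic ⧸
        Subgroup.centralizer ({γ} : Set (quasiSplit (↥(maximalRealSubfield L)) L (IsCMField.complexConj L) 3).Adelic))]
    [instMS : ∀ γ : (quasiSplit (↥(maximalRealSubfield L)) L (IsCMField.complexConj L) 3).Adelic,
      MeasurableSpace (↥(Subgroup.centralizer ({γ} : Set (quasiSplit (↥(maximalRealSubfield L)) L (IsCMField.complexConj L) 3).Adelic)) ⧸
        ((quasiSplit (↥(maximalRealSubfield L)) L (IsCMField.complexConj L) 3).quotientSubgroup ⊓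
          Subgroup.centralizer ({γ} : Set (quasiSplit (↥(maximalRealSubfield L)) L (IsCMField.complexConj L) 3).Adelic)).subgroupOf
          (Subgroup.centralizer ({γ} : Set (quasiSplit (↥(maximalRealSubfield L)) L (IsCMField.complexConj L) 3).Adelic)))]
    [instBS : ∀ γ : (quasiSplit (↥(maximalRealSubfield L)) L (IsCMField.complexConj L) 3).Adelic,
      BorelSpace (↥(Subgroup.centralizer ({γ} : Set (quasiSplit (↥(maximalRealSubfield L)) L (IsCMField.complexConj L) 3).Adelic)) ⧸
        ((quasiSplit (↥(maximalRealSubfield L)) L (IsCMField.complexConj L) 3).quotientSubgroup ⊓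
          Subgroup.centralizer ({γ} : Set (quasiSplit (↥(maximalRealSubfield L)) L (IsCMField.complexConj L) 3).Adelic)).subgroupOf
          (Subgroup.centralizer ({γ} : Set (quasiSplit (↥(maximalRealSubfield L)) L (IsCMField.complexConj L) 3).Adelic)))]
    (ν₀ : Measure (adelicUnipotent (↥(maximalRealSubfield L)) L (IsCMField.complexConj L) 3)) [instν₀ : ν₀.IsHaarMeasure]
    (𝓕 : Set (adelicUnipotent (↥(maximalRealSubfield L)) L (IsCMField.complexConj L) 3))
    (h𝓕 : IsFundamentalDomain (rationalUnipotent (↥(maximalRealSubfield L)) L (IsCMField.complexConj L) 3) 𝓕 ν₀)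
    (μ : Measure (quasiSplit (↥(maximalRealSubfield L)) L (IsCMField.complexConj L) 3).automorphicQuotient)
    [instμ : (quasiSplit (↥(maximalRealSubfield L)) L (IsCMField.complexConj L) 3).IsAutomorphicMeasure μ]
    (ν : Measure (quasiSplit (↥(maximalRealSubfield L)) L (IsCMField.complexConj L) 3).Adelic) [instν : IsHaarMeasure ν]
    (rep : ConjClasses ↥(quasiSplit (↥(maximalRealSubfield L)) L (IsCMField.complexConj L) 3).arithmeticSubgroup → ↥(quasiSplit (↥(maximalRealSubfield L)) L (IsCMField.complexConj L) 3).arithmeticSubgroup)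
    (hrep : ∀ s, ConjClasses.mk (rep s) = s)
    (νC : ∀ s : ConjClasses ↥(quasiSplit (↥(maximalRealSubfield L)) L (IsCMField.complexConj L) 3).arithmeticSubgroup,
      Measure ↥(Subgroup.centralizer ({((rep s : ↥(quasiSplit (↥(maximalRealSubfield L)) L (IsCMField.complexConj L) 3).arithmeticSubgroup) : (quasiSplit (↥(maximalRealSubfield L)) L (IsCMField.complexConj L) 3).Adelic)} : Set (quasiSplit (↥(maximalRealSubfield L)) L (IsCMField.complexConj L) 3).Adelic)))
    [instνC : ∀ s, IsHaarMeasure (νC s)]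
    (f : (quasiSplit (↥(maximalRealSubfield L)) L (IsCMField.complexConj L) 3).Adelic → ℂ)
    (hf : IsQuasiSplitTest (↥(maximalRealSubfield L)) L (IsCMField.complexConj L) 3 f) :
    haveI := t2Space_quasiSplitAdelic (F := ↥(maximalRealSubfield L)) (E := L) (c := IsCMField.complexConj L) (N := 3)
    haveI := locallyCompactSpace_quasiSplitAdelic (F := ↥(maximalRealSubfield L)) (E := L) (c := IsCMField.complexConj L) (N := 3)
    haveI := secondCountableTopology_quasiSplitAdelic (F := ↥(maximalRealSubfield L)) (E := L) (c := IsCMField.complexConj L) (N := 3)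
    haveI : IsClosed (((quasiSplit (↥(maximalRealSubfield L)) L (IsCMField.complexConj L) 3).quotientSubgroup : Set (quasiSplit (↥(maximalRealSubfield L)) L (IsCMField.complexConj L) 3).Adelic)) :=
      isClosed_quotientSubgroup_quasiSplit
    haveI : ∀ γ : (quasiSplit (↥(maximalRealSubfield L)) L (IsCMField.complexConj L) 3).Adelic, IsClosed ((Subgroup.centralizer ({γ} : Set (quasiSplit (↥(maximalRealSubfield L)) L (IsCMField.complexConj L) 3).Adelic) :
        Subgroup (quasiSplit (↥(maximalRealSubfield L)) L (IsCMField.complexConj L) 3).Adelic) : Set (quasiSplit (↥(maximalRealSubfield L)) L (IsCMField.complexConj L) 3).Adelic) := isClosed_centralizer_quasiSplit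
    haveI : ∀ γ : (quasiSplit (↥(maximalRealSubfield L)) L (IsCMField.complexConj L) 3).Adelic, (count : Measure ↥(((quasiSplit (↥(maximalRealSubfield L)) L (IsCMField.complexConj L) 3).quotientSubgroup ⊓
        Subgroup.centralizer ({γ} : Set (quasiSplit (↥(maximalRealSubfield L)) L (IsCMField.complexConj L) 3).Adelic)).subgroupOf
          (Subgroup.centralizer ({γ} : Set (quasiSplit (↥(maximalRealSubfield L)) L (IsCMField.complexConj L) 3).Adelic)))).IsHaarMeasure :=
      isHaarMeasure_count_inf_centralizer_subgroupOf_quasiSplit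
    haveI : (count : Measure (quasiSplit (↥(maximalRealSubfield L)) L (IsCMField.complexConj L) 3).quotientSubgroup).IsHaarMeasure :=
      isHaarMeasure_count_quotientSubgroup_quasiSplit
    haveI : ν.IsMulRightInvariant := isMulRightInvariant_quasiSplit_cm_three L ν
    letI := AdelicGroupData.measurableSpaceQuotientForm (quasiSplit (↥(maximalRealSubfield L)) L (IsCMField.complexConj L) 3)
    haveI := AdelicGroupData.borelSpaceQuotientForm (quasiSplit (↥(maximalRealSubfield L)) L (IsCMField.complexConj L) 3)
    haveI := AdelicGroupData.smulInvariantMeasureQuotientForm (quasiSplit (↥(maximalRealSubfield L)) L (IsCMField.complexConj L) 3) μ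
    haveI := AdelicGroupData.isFiniteMeasureOnCompactsQuotientForm (quasiSplit (↥(maximalRealSubfield L)) L (IsCMField.complexConj L) 3) μ
    ∃ S : Finset (AdeleRing (𝓞 L) L)[X], ∃ P : (AdeleRing (𝓞 L) L)[X] → ℂ[X],
      (∀ i, (P i).natDegree ≤ 1) ∧
      (∀ i ∈ S, ∃ T₀ : ℝ≥0, ∀ T : ℝ≥0, T₀ < T → truncatedTraceClass μ ν₀ 𝓕 T
          (fun γ : ↥(quasiSplit (↥(maximalRealSubfield L)) L (IsCMField.complexConj L) 3).arithmeticSubgroup =>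
                  ((adelicVal (↥(maximalRealSubfield L)) L (IsCMField.complexConj L) 3 _ (γ : (quasiSplit (↥(maximalRealSubfield L)) L (IsCMField.complexConj L) 3).Adelic) :
                    GL (Fin 3) (AdeleRing (𝓞 L) L)) : Matrix (Fin 3) (Fin 3) (AdeleRing (𝓞 L) L)).charpoly) i f =
            (P i).eval ((Real.log (T : ℝ) : ℝ) : ℂ)) ∧
      truncatedTracePolynomial μ ν₀ 𝓕 f = ∑ i ∈ S, P i ∧
      (∀ i ∈ S, (∀ β : arithmeticBorel (↥(maximalRealSubfield L)) L (IsCMField.complexConj L) 3,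
          (fun γ : ↥(quasiSplit (↥(maximalRealSubfield L)) L (IsCMField.complexConj L) 3).arithmeticSubgroup =>
                  ((adelicVal (↥(maximalRealSubfield L)) L (IsCMField.complexConj L) 3 _ (γ : (quasiSplit (↥(maximalRealSubfield L)) L (IsCMField.complexConj L) 3).Adelic) :
                    GL (Fin 3) (AdeleRing (𝓞 L) L)) : Matrix (Fin 3) (Fin 3) (AdeleRing (𝓞 L) L)).charpoly) β ≠ i) →
        ∀ T : ℝ≥0, P i = C (truncatedTraceClass μ ν₀ 𝓕 T
          (fun γ : ↥(quasiSplit (↥(maximalRealSubfield L)) L (IsCMField.complexConj L) 3).arithmeticSubgroup =>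
                  ((adelicVal (↥(maximalRealSubfield L)) L (IsCMField.complexConj L) 3 _ (γ : (quasiSplit (↥(maximalRealSubfield L)) L (IsCMField.complexConj L) 3).Adelic) :
                    GL (Fin 3) (AdeleRing (𝓞 L) L)) : Matrix (Fin 3) (Fin 3) (AdeleRing (𝓞 L) L)).charpoly) i f)) ∧
      ∀ T : ℝ≥0, arthurTrace μ ν₀ 𝓕 f =
        (∑ i ∈ (S.filter (fun i => ∀ β : arithmeticBorel (↥(maximalRealSubfield L)) L (IsCMField.complexConj L) 3,
                (fun γ : ↥(quasiSplit (↥(maximalRealSubfield L)) L (IsCMField.complexConj L) 3).arithmeticSubgroup =>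
                  ((adelicVal (↥(maximalRealSubfield L)) L (IsCMField.complexConj L) 3 _ (γ : (quasiSplit (↥(maximalRealSubfield L)) L (IsCMField.complexConj L) 3).Adelic) :
                    GL (Fin 3) (AdeleRing (𝓞 L) L)) : Matrix (Fin 3) (Fin 3) (AdeleRing (𝓞 L) L)).charpoly) β ≠ i)).attach,
          ((unfoldingConstant (quasiSplit (↥(maximalRealSubfield L)) L (IsCMField.complexConj L) 3).quotientSubgroup
              (count : Measure (quasiSplit (↥(maximalRealSubfield L)) L (IsCMField.complexConj L) 3).quotientSubgroup) μ ν : ℝ) : ℂ) *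
            ∑' s : {s : ConjClasses ↥(quasiSplit (↥(maximalRealSubfield L)) L (IsCMField.complexConj L) 3).arithmeticSubgroup //
                (fun γ : ↥(quasiSplit (↥(maximalRealSubfield L)) L (IsCMField.complexConj L) 3).arithmeticSubgroup =>
                  ((adelicVal (↥(maximalRealSubfield L)) L (IsCMField.complexConj L) 3 _ (γ : (quasiSplit (↥(maximalRealSubfield L)) L (IsCMField.complexConj L) 3).Adelic) :
                    GL (Fin 3) (AdeleRing (𝓞 L) L)) : Matrix (Fin 3) (Fin 3) (AdeleRing (𝓞 L) L)).charpoly) (rep s) = i.1},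
              (haveI : (νC s.1).IsMulRightInvariant :=
                  isMulRightInvariant_centralizer_of_forall_cl_ne (complexConj_mul_complexConj L)
                    isConjInvariant_charpoly_adelicVal (Finset.mem_filter.1 i.2).2 s.2 (νC s.1);
                haveI : (νC s.1).IsInvInvariant :=
                  isInvInvariant_centralizer_of_forall_cl_ne (complexConj_mul_complexConj L)
                    isConjInvariant_charpoly_adelicVal (Finset.mem_filter.1 i.2).2 s.2 (νC s.1);
                ((quotientMeasure (((quasiSplit (↥(maximalRealSubfield L)) L (IsCMField.complexConj L) 3).quotientSubgroup ⊓
                    Subgroup.centralizer ({((rep s.1 : ↥(quasiSplit (↥(maximalRealSubfield L)) L (IsCMField.complexConj L) 3).arithmeticSubgroup) : (quasiSplit (↥(maximalRealSubfield L)) L (IsCMField.complexConj L) 3).Adelic)} : Set (quasiSplit (↥(maximalRealSubfield L)) L (IsCMField.complexConj L) 3).Adelic)).subgroupOf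
                    (Subgroup.centralizer ({((rep s.1 : ↥(quasiSplit (↥(maximalRealSubfield L)) L (IsCMField.complexConj L) 3).arithmeticSubgroup) : (quasiSplit (↥(maximalRealSubfield L)) L (IsCMField.complexConj L) 3).Adelic)} : Set (quasiSplit (↥(maximalRealSubfield L)) L (IsCMField.complexConj L) 3).Adelic)))
                    count (isClosed_inf_centralizer_subgroupOf_quasiSplit _) (νC s.1) Set.univ).toReal : ℂ) *
                  orbitalIntegral ((rep s.1 : ↥(quasiSplit (↥(maximalRealSubfield L)) L (IsCMField.complexConj L) 3).arithmeticSubgroup) : (quasiSplit (↥(maximalRealSubfield L)) L (IsCMField.complexConj L) 3).Adelic) f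
                    (quotientMeasure (Subgroup.centralizer ({((rep s.1 : ↥(quasiSplit (↥(maximalRealSubfield L)) L (IsCMField.complexConj L) 3).arithmeticSubgroup) : (quasiSplit (↥(maximalRealSubfield L)) L (IsCMField.complexConj L) 3).Adelic)} : Set (quasiSplit (↥(maximalRealSubfield L)) L (IsCMField.complexConj L) 3).Adelic)) (νC s.1)
                      (isClosed_centralizer_quasiSplit _) ν))) +
        ∑ i ∈ S.filter (fun i => ¬ ∀ β : arithmeticBorel (↥(maximalRealSubfield L)) L (IsCMField.complexConj L) 3,
                (fun γ : ↥(quasiSplit (↥(maximalRealSubfield L)) L (IsCMField.complexConj L) 3).arithmeticSubgroup =>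
                  ((adelicVal (↥(maximalRealSubfield L)) L (IsCMField.complexConj L) 3 _ (γ : (quasiSplit (↥(maximalRealSubfield L)) L (IsCMField.complexConj L) 3).Adelic) :
                    GL (Fin 3) (AdeleRing (𝓞 L) L)) : Matrix (Fin 3) (Fin 3) (AdeleRing (𝓞 L) L)).charpoly) β ≠ i),
          (P i).eval 0 := by
  have h3d := @arthurTrace_eq_sum_offBorel_add_sum_charpoly_cm L _ _ _ instMU instBU ν₀ instν₀ 𝓕 h𝓕 μ instμ f hf
  obtain ⟨S, P, hdeg, hP, hpoly, hC, hJ⟩ := h3d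
  refine ⟨S, P, hdeg, hP, hpoly, hC, fun T => (hJ T).trans ?_⟩
  congr 1
  refine (Finset.sum_attach _ _).symm.trans (Finset.sum_congr rfl fun i _ => ?_)
  exact @truncatedTraceClass_eq_mul_tsum_covol_mul_orbitalIntegral_cm L _ _ _ instMA instBA instMU instMQ instBQ instMS
    instBS μ instμ ν instν _ _ isConjInvariant_charpoly_adelicVal i.1 rep hrep (fun s => νC s.1) (fun s => instνC s.1)
    (Finset.mem_filter.1 i.2).2 f hf ν₀ 𝓕 T

end UnitaryGroup

end Literature.NumberTheory.Automorphic
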